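import Summits.CriticalPhenomena.Ising3D.TaylorFunctionalZSeries
import Literature.MathematicalPhysics.QuantumFieldTheory.ConformalBootstrap3D.MixedBlockCauchySchwarz
import Mathlib.Tactic.Linarith
import Mathlib.Tactic.Positivity
import Mathlib.Tactic.Ring
import HarnessLib

/-!
# A derivative functional acts termwise on the `z`-series of the MIXED-channel blocks (`gpm`, `gmm`)
(cell `pub-ising3x`, seat boot-1; gate (g0′′) of the M3-γ milestone, odd sector: the derivative
analogue of `BlockZSeriesAB.hasSum_pointFunctional_crossF_hrZAB` and of the signed `⟨σεσε⟩` series)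

HONEST FRAMING: lottery ticket; floor = tightest certified 3D Ising CFT bounds; no exact-solution
claim without a proof.

* `IsTaylorFunctional.hasSum_crossF_zMono_series` — the GENERIC step: a coefficient function `c`
  supported on the descendant range, a pointwise identity `Σ c_q 𝒫_{Δ+n,j} = g` on the square, and a
  non-negative dominating `d ≥ |c|` whose series against `𝒫_{Δ+n,j}(X,X)` converges at every diagonal
  point, give `Σ_q c_q φ[crossF s σ 𝒫_{Δ+n,j}] = φ[crossF s σ g]` for every Taylor functional `φ` at
  `(x,x)` (M-test of `TaylorFunctional`, term germs from `crossF_germ_majorant` with the finite array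
  `zLegendreArr`);
* `…_hrZTermAB_self` — the reflection-positive family `a = b` (`gpm = g^{-Δσε,Δσε}`, non-negative
  coefficients `A_{n,j}(a,a)`), at regular points strictly above the unitarity bound;
* `…_hrZTermAB_neg` — the SIGNED family `a = -b` (`gmm = g^{Δσε,Δσε}` of sum rule 3), dominated
  coefficient-wise by the `⟨εσσε⟩` block and its Dolan–Osborn conjugate (`abs_hrCoeffAB_neg_le`), so
  the series of a derivative functional's values converges absolutely — the typed starting point of the
  L-odd-tail lemma (g1) and of the odd-sector region check (g2).
Regularity (`¬ accidentalDegeneracy3D`) is assumed exactly as in the tree's `hasSum_hrZTermAB`.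
Sources: Dolan–Osborn 2004 §3 eqs. (3.9)–(3.12) as typed in `BlockZSeriesAB` / `MixedBlockCauchySchwarz`.
-/

namespace Summit.CriticalPhenomena.Ising3D

open Finset Set
open Literature.MathematicalPhysics.QuantumFieldTheory.ConformalBootstrap3D

/-- **Generic termwise evaluation on a `𝒫_{Δ+n,j}`-series.** See the module docstring. [folklore] -/
theorem IsTaylorFunctional.hasSum_crossF_zMono_series {x : ℝ} (hx0 : 0 < x) (hx1 : x < 1)
    {φ : (ℝ → ℝ → ℝ) →ₗ[ℝ] ℝ} (hφ : IsTaylorFunctional x x φ) (s σ : ℝ) {Δ : ℝ} {ℓ : ℕ}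
    (hℓΔ : (ℓ : ℝ) ≤ Δ) {g : ℝ → ℝ → ℝ} (c d : ℕ × ℕ → ℝ)
    (hcz : ∀ q : ℕ × ℕ, ℓ + q.1 < q.2 → c q = 0) (hcd : ∀ q, |c q| ≤ d q)
    (hg : ∀ z zb : ℝ, z ∈ Ioo (0 : ℝ) 1 → zb ∈ Ioo (0 : ℝ) 1 →
      HasSum (fun q : ℕ × ℕ => c q * zMono (Δ + (q.1 : ℝ)) q.2 z zb) (g z zb))
    (hd : ∀ X : ℝ, 0 < X → X < 1 →
      Summable (fun q : ℕ × ℕ => d q * zMono (Δ + (q.1 : ℝ)) q.2 X X)) :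
    HasSum (fun q : ℕ × ℕ => c q * φ (crossF s σ (zMono (Δ + (q.1 : ℝ)) q.2))) (φ (crossF s σ g)) := by
  have hr : 0 < x * (1 - x) := mul_pos hx0 (by linarith)
  set ρ := x * (1 - x) / 2 with hρdef
  have hρ0 : 0 < ρ := by rw [hρdef]; linarith
  have hρ : ρ < x * (1 - x) := by rw [hρdef]; linarith
  have hX₁ := bgX₁_pos_lt hx0 hρ
  have hX₂ := bgX₂_pos_lt hx1 hρ
  have hd0 : ∀ q, 0 ≤ d q := fun q => (abs_nonneg _).trans (hcd q)
  set F : ℕ × ℕ → ℝ → ℝ → ℝ := fun q =>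
    if q.2 ≤ ℓ + q.1 then crossF s σ (zMono (Δ + (q.1 : ℝ)) q.2) else 0 with hF
  have hcz' : ∀ q : ℕ × ℕ, ¬ q.2 ≤ ℓ + q.1 → c q = 0 := fun q hq => hcz q (by omega)
  -- Step 1: summable germs
  have hG : HasSummableGerms c F x x ρ := by
    have hex : ∀ q : ℕ × ℕ, ∃ (T : ℕ × ℕ → ℝ) (N : ℝ), HasTaylorGerm (F q) x x (x * (1 - x)) T ∧
        HasSum (fun p : ℕ × ℕ => |T p| * ρ ^ p.1 * ρ ^ p.2) N ∧
        N ≤ bgC₁ s x ρ * zMono (Δ + (q.1 : ℝ)) q.2 (bgX₁ x ρ) (bgX₁ x ρ) +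
          |σ| * (bgC₂ s x ρ * zMono (Δ + (q.1 : ℝ)) q.2 (bgX₂ x ρ) (bgX₂ x ρ)) := by
      intro q
      by_cases hq : q.2 ≤ ℓ + q.1
      · have hτ : 0 ≤ (Δ + (q.1 : ℝ) - (q.2 : ℝ)) / 2 := by
          have : (q.2 : ℝ) ≤ ℓ + q.1 := by exact_mod_cast hq
          linarith
        obtain ⟨T, N, hT, hN, hle⟩ := crossF_germ_majorant (isDoublePowerSeriesOn_zLegendreArr q.2) hτ
          hx0 hx1 (g := zMono (Δ + (q.1 : ℝ)) q.2) (fun z zb _ _ => rfl) s σ hρ0 hρ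
        refine ⟨T, N, ?_, hN, ?_⟩
        · simp only [hF, if_pos hq]; exact hT
        · rw [zMono_value_eq _ _ hX₁.1 hX₁.2, zMono_value_eq _ _ hX₂.1 hX₂.2] at hle
          exact hle
      · refine ⟨0, 0, ?_, ?_, ?_⟩
        · simp only [hF, if_neg hq]; exact hasTaylorGerm_zero x x hr
        · simp
        · have h1 := zMono_nonneg (Δ + (q.1 : ℝ)) q.2 hX₁.1.le hX₁.1.le
          have h2 := zMono_nonneg (Δ + (q.1 : ℝ)) q.2 hX₂.1.le hX₂.1.le
          have : 0 ≤ bgC₁ s x ρ := sq_nonneg _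
          have : 0 ≤ bgC₂ s x ρ := sq_nonneg _
          positivity
    choose T N hT hN hle using hex
    refine ⟨x * (1 - x), T, N, hρ.le, hT, hN, ?_⟩
    have hZ₁ := hd _ hX₁.1 hX₁.2
    have hZ₂ := hd _ hX₂.1 hX₂.2
    refine ((hZ₁.mul_left (bgC₁ s x ρ)).add (hZ₂.mul_left (|σ| * bgC₂ s x ρ))).of_nonneg_of_le
      (fun q => mul_nonneg (abs_nonneg _) ((hN q).nonneg fun p => by positivity)) fun q => ?_
    have h1 := zMono_nonneg (Δ + (q.1 : ℝ)) q.2 hX₁.1.le hX₁.1.le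
    have h2 := zMono_nonneg (Δ + (q.1 : ℝ)) q.2 hX₂.1.le hX₂.1.le
    have hC₁ : 0 ≤ bgC₁ s x ρ := sq_nonneg _
    have hC₂ : 0 ≤ bgC₂ s x ρ := sq_nonneg _
    calc |c q| * N q ≤ d q * (bgC₁ s x ρ * zMono (Δ + (q.1 : ℝ)) q.2 (bgX₁ x ρ) (bgX₁ x ρ) +
          |σ| * (bgC₂ s x ρ * zMono (Δ + (q.1 : ℝ)) q.2 (bgX₂ x ρ) (bgX₂ x ρ))) :=
          mul_le_mul (hcd q) (hle q) ((hN q).nonneg fun p => by positivity) (hd0 q)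
      _ = bgC₁ s x ρ * (d q * zMono (Δ + (q.1 : ℝ)) q.2 (bgX₁ x ρ) (bgX₁ x ρ)) +
          |σ| * bgC₂ s x ρ * (d q * zMono (Δ + (q.1 : ℝ)) q.2 (bgX₂ x ρ) (bgX₂ x ρ)) := by ring
  -- Step 2: the pointwise identity pushed through `crossF`
  have hS : ∀ h k : ℝ, |h| < ρ → |k| < ρ →
      HasSum (fun q => c q * F q (x + h) (x + k)) (crossF s σ g (x + h) (x + k)) := by
    intro h k hh hk
    have hz := mem_Ioo_of_abs_lt (hh.trans hρ)
    have hzb := mem_Ioo_of_abs_lt (hk.trans hρ)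
    have hpt : ∀ z zb : ℝ, z ∈ Ioo (0 : ℝ) 1 → zb ∈ Ioo (0 : ℝ) 1 →
        HasSum (fun q : ℕ × ℕ => (fun x' y' => c q * zMono (Δ + (q.1 : ℝ)) q.2 x' y') z zb)
          (g z zb) := fun z zb hz hzb => hg z zb hz hzb
    have h1 := hasSum_crossF s σ hpt hz hzb
    refine h1.congr_fun fun q => ?_
    by_cases hq : q.2 ≤ ℓ + q.1
    · simp only [hF, if_pos hq, crossF]
      ring
    · simp only [hF, if_neg hq, hcz' q hq, crossF, Pi.zero_apply]
      ring
  -- Step 3: M-test and undo the modification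
  have hmain := hφ.hasSum_mul_of_hasSummableGerms hρ0 hG (crossF s σ g) hS
  refine hmain.congr_fun fun q => ?_
  by_cases hq : q.2 ≤ ℓ + q.1
  · simp only [hF, if_pos hq]
  · simp only [hcz' q hq, zero_mul]

/-- **Termwise evaluation on the `z`-series of a reflection-positive mixed block** (`a = b`; e.g.
`gpm = g^{-Δσε,Δσε}` with `a = Δσε/2`), regular point strictly above the unitarity bound.
[cite: DolanOsborn2004, §3 eqs. (3.9)–(3.12)] -/
theorem IsTaylorFunctional.hasSum_crossF_hrZTermAB_self {x : ℝ} (hx0 : 0 < x) (hx1 : x < 1)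
    {φ : (ℝ → ℝ → ℝ) →ₗ[ℝ] ℝ} (hφ : IsTaylorFunctional x x φ) (s σ : ℝ) {Δ₁₂ Δ₃₄ Δ : ℝ} {ℓ : ℕ}
    {g : ℝ → ℝ → ℝ} (hΔ : unitarityBound3D ℓ < Δ) (hreg : ¬ accidentalDegeneracy3D Δ ℓ)
    (hab : Δ₁₂ = -Δ₃₄) (hg : IsConformalBlock3D Δ₁₂ Δ₃₄ Δ ℓ g) :
    HasSum (fun q : ℕ × ℕ => hrCoeffAB (Δ₃₄ / 2) (Δ₃₄ / 2) Δ ℓ q.1 q.2 / legendreLam ℓ *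
        φ (crossF s σ (zMono (Δ + (q.1 : ℝ)) q.2))) (φ (crossF s σ g)) := by
  have hℓΔ : (ℓ : ℝ) ≤ Δ := (natCast_le_unitarityBound3D ℓ).trans hΔ.le
  refine hφ.hasSum_crossF_zMono_series hx0 hx1 s σ hℓΔ _
    (fun q => hrCoeffAB (Δ₃₄ / 2) (Δ₃₄ / 2) Δ ℓ q.1 q.2 / legendreLam ℓ) (fun q hq => ?_)
    (fun q => le_of_eq (abs_of_nonneg (div_nonneg (hrCoeffAB_self_nonneg _ hΔ _ _)
      (legendreLam_pos ℓ).le))) (fun z zb hz hzb => hg.hasSum_hrZTermAB hΔ hreg hab hz hzb)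
    fun X hX0 hX1 => (hg.hasSum_hrZTermAB hΔ hreg hab (x := X) (y := X) ⟨hX0, hX1⟩ ⟨hX0, hX1⟩).summable
  rw [hrCoeffAB_eq_zero_of_lt _ _ _ hq, zero_div]

/-- **Termwise evaluation on the SIGNED `⟨σεσε⟩` series** (`a = -b`): for `gmm` with
`IsConformalBlock3D t t Δ ℓ gmm` and its companion `gpm` (`IsConformalBlock3D (-t) t Δ ℓ gpm`), at a
regular point strictly above the bound with `Δ ≠ 1` if `ℓ = 0`,
`Σ_{(n,j)} (A_{n,j}(-t/2, t/2)/λ_ℓ) φ[crossF s σ 𝒫_{Δ+n,j}] = φ[crossF s σ gmm]`.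
[cite: DolanOsborn2004, §3 eq. (3.11)] -/
theorem IsTaylorFunctional.hasSum_crossF_hrZTermAB_neg {x : ℝ} (hx0 : 0 < x) (hx1 : x < 1)
    {φ : (ℝ → ℝ → ℝ) →ₗ[ℝ] ℝ} (hφ : IsTaylorFunctional x x φ) (s σ : ℝ) {t Δ : ℝ} {ℓ : ℕ}
    {gmm gpm : ℝ → ℝ → ℝ} (hΔ : unitarityBound3D ℓ < Δ) (hreg : ¬ accidentalDegeneracy3D Δ ℓ)
    (h1 : ℓ = 0 → Δ ≠ 1) (hmm : IsConformalBlock3D t t Δ ℓ gmm)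
    (hpm : IsConformalBlock3D (-t) t Δ ℓ gpm) :
    HasSum (fun q : ℕ × ℕ => hrCoeffAB (-t / 2) (t / 2) Δ ℓ q.1 q.2 / legendreLam ℓ *
        φ (crossF s σ (zMono (Δ + (q.1 : ℝ)) q.2))) (φ (crossF s σ gmm)) := by
  have hℓΔ : (ℓ : ℝ) ≤ Δ := (natCast_le_unitarityBound3D ℓ).trans hΔ.le
  have hlam := legendreLam_pos ℓ
  -- the conjugate companion `v^t gpm`, a genuine `(t, -t)` block
  have hconj : IsConformalBlock3D t (-t) Δ ℓ (conjBlock t gpm) := by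
    have h := hpm.conj
    have he : (t - -t) / 2 = t := by ring
    rw [neg_neg, he] at h
    exact h
  refine hφ.hasSum_crossF_zMono_series hx0 hx1 s σ hℓΔ _
    (fun q => (hrCoeffAB (t / 2) (t / 2) Δ ℓ q.1 q.2 + hrCoeffAB (-t / 2) (-t / 2) Δ ℓ q.1 q.2) /
      (2 * legendreLam ℓ)) (fun q hq => ?_) (fun q => ?_)
    (fun z zb hz hzb => (hmm.hasSum_hrZTermAB_neg hΔ hreg h1 hpm hz hzb).1) fun X hX0 hX1 => ?_
  · rw [hrCoeffAB_eq_zero_of_lt _ _ _ hq, zero_div]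
  · have hb := abs_hrCoeffAB_neg_le (a := -t / 2) hΔ h1 q.1 q.2
    rw [show -(-t / 2) = t / 2 by ring] at hb
    rw [abs_div, abs_of_pos hlam, div_le_div_iff₀ hlam (by positivity)]
    nlinarith [hb, hlam]
  · have hP := (hpm.hasSum_hrZTermAB hΔ hreg (by ring) (x := X) (y := X) ⟨hX0, hX1⟩
      ⟨hX0, hX1⟩).summable
    have hQ := (hconj.hasSum_hrZTermAB hΔ hreg (by ring) (x := X) (y := X) ⟨hX0, hX1⟩
      ⟨hX0, hX1⟩).summable
    refine ((hP.add hQ).div_const 2).congr fun q => ?_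
    simp only [hrZTermAB]
    field_simp

end Summit.CriticalPhenomena.Ising3D
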